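import Summits.Ventures.Crystal3D.Theorems.StickyWulffConstantGenericWallFloorTwistedSquare
import HarnessLib

/-!
# The PRISM-FACE WITNESS: an hcp half-crystal whose face ball carries the twisted-square dozen — the walker method's ceiling
# on lane T (crux `TextureLiminf`, stmt-Ventures-19483; recorded for `GenericWallFloor`, stmt-Ventures-19480, line `WallLedgerG`)

HONEST FRAMING. Venture `Summits/Ventures/Crystal3D` (cell `crystal3d-full`), helper `--supports stmt-Ventures-19483`
(`TextureLiminf`, line TexShadow, «zigzag deficit» residual of the re-keyed wall stub; planner cf-p1 ROUTE §86(33)/(34),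
ask of 2026-08-28T14:15:25Z).  Rung credit only; F-C1 not moved; NOT a stub.  A KERNEL NEGATIVE about the walker METHOD:

Take the hcp crystal around the ball `y = 0` (integer model `hcpSiteInt k i j` in the frame of `hcpInt`, unit length ↔ norm²
`18`: layer `k`, in-layer coordinates `i, j`; layers `A B A B …`, `y`'s dozen = `hcpInt`, `hcpSiteInt_dozen`), keep the CLOSED
HALF on the non-negative side of the PRISM PLANE through `y` spanned by the c-axis `(1,1,1)` and the hexagon pair `±(3,0,−3)`
(normal `(−1,2,−1)`, `prismSide`), and add the four TWISTED balls of `…TwistedSquare`.  Then (all by `decide` on integers,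
transported to `ℝ³`):
* `prismFace_dozen_of_y` — the half-crystal balls touching `y` are EXACTLY the eight own balls `O₁₇₄₃` (the other four hcp
  neighbours of `y` lie strictly on the negative side);
* **`prismFaceTwisted_separated`** — every half-crystal ball other than `y` with indices in `[−2,2]³` is at distance `> 1`
  from each twisted ball (minimum `√(1353970890/1348362450) = 1.00208`); `prismFaceTwisted_separated_far` — every site at
  distance `≥ 2` from `y` trivially is (`≥ 1`); `hcpSiteInt_near_complete` — every site at distance `< 2` from `y` with indices
  in `[−4,4]³` has indices in `[−2,2]³` (so the two statements cover the half-crystal);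
* **`prismFaceTwisted_saturated_irregular`** — `y` is 12-coordinated in «half-crystal ∪ twisted four» by the dozen
  `twistedDozen ⊇ O₁₇₄₃`, a kissing arrangement that is NOT a linear-isometric image of the FCC or HCP pattern, and its
  eight own balls are half-crystal balls.
So a perfect hcp grain terminated by a prism face can carry, at a face ball `y`, a SATURATED IRREGULAR dozen while every ball
behind `y` is hcp-full: no own-pattern / k-ball-history certificate licenses IN-PLANE stack walkers across a prism face
(«E1-h», «E1-h₂» of ROUTE §86(32)–(34) refuted) — the charge `min(1, ½(κ₁+κ₂))` of memo WALKER-COVERAGE-g7 is the walker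
method's ceiling on Barlow|Barlow walls.

WHAT THIS IS NOT: not an energy statement (the twisted balls are themselves unsaturated and pay — just not to a walker);
nothing about c-layers; F-C1 not moved.
-/

noncomputable section

namespace Summit.Ventures.Crystal3D.Theorems

open Finset Literature.Geometry.DiscreteGeometry Literature.Barriers.AtomisticToContinuum

/-! ### The integer model of the hcp crystal around `y = 0` (frame of `hcpInt`, norm² `18` = unit length) -/

/-- Site `(k, i, j)` of the hcp crystal through `y = 0`: in-layer generators `(3,−3,0)`, `(3,0,−3)` (hexagon vectors of
`hcpInt`), two layers up `= (4,4,4)`, odd layers offset by the polar vector `(3,3,0)` (Euclidean `k / 2`, `k % 2`). -/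
def hcpSiteInt (k i j : ℤ) : Fin 3 → ℤ :=
  i • ![3, -3, 0] + j • ![3, 0, -3] + (k / 2) • ![4, 4, 4] + (k % 2) • ![3, 3, 0]

/-- The side of the PRISM PLANE through `y` containing the c-axis `(1,1,1)` and the hexagon pair `±(3,0,−3)`:
`⟪v, (−1,2,−1)⟫`; the own pattern `O₁₇₄₃` is the closed non-negative side of `y`'s dozen. -/
def prismSide (v : Fin 3 → ℤ) : ℤ := -v 0 + 2 * v 1 - v 2

/-- The index box `[−2,2]³` (all sites within distance `< 2` of `y`, `hcpSiteInt_near_complete`). -/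
def prismBox : Finset (ℤ × ℤ × ℤ) :=
  ({-2, -1, 0, 1, 2} : Finset ℤ) ×ˢ ({-2, -1, 0, 1, 2} : Finset ℤ) ×ˢ ({-2, -1, 0, 1, 2} : Finset ℤ)

/-- The larger index box `[−4,4]³` (for the completeness check). -/
def prismBigBox : Finset (ℤ × ℤ × ℤ) :=
  ({-4, -3, -2, -1, 0, 1, 2, 3, 4} : Finset ℤ) ×ˢ ({-4, -3, -2, -1, 0, 1, 2, 3, 4} : Finset ℤ) ×ˢ
    ({-4, -3, -2, -1, 0, 1, 2, 3, 4} : Finset ℤ)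

/-! ### Integer checks (`decide`) -/

/-- **`y`'s dozen is `hcpInt`**: the sites at squared distance `18` from `y` (indices in the box) are exactly the twelve HCP
vectors, and each HCP vector is a site. -/
theorem hcpSiteInt_dozen :
    (∀ t ∈ prismBox, sqNormInt (hcpSiteInt t.1 t.2.1 t.2.2) = 18 ↔ hcpSiteInt t.1 t.2.1 t.2.2 ∈ hcpInt) ∧
    (∀ v ∈ hcpInt, ∃ t ∈ prismBox, hcpSiteInt t.1 t.2.1 t.2.2 = v) := by
  refine ⟨?_, ?_⟩ <;> decide +kernel

/-- **Completeness of the box**: every site with indices in `[−4,4]³` at squared distance `< 72` (distance `< 2`) from `y` has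
its indices in `[−2,2]³`. -/
theorem hcpSiteInt_near_complete :
    ∀ t ∈ prismBigBox, sqNormInt (hcpSiteInt t.1 t.2.1 t.2.2) < 72 → t ∈ prismBox := by decide +kernel

/-- **The own pattern is the non-negative half of `y`'s dozen**: a neighbour site of `y` lies on the closed non-negative side
of the prism plane iff it is one of the eight vectors of `O₁₇₄₃`. -/
theorem prismFace_dozen_of_y :
    ∀ t ∈ prismBox, sqNormInt (hcpSiteInt t.1 t.2.1 t.2.2) = 18 →
      (0 ≤ prismSide (hcpSiteInt t.1 t.2.1 t.2.2) ↔ hcpSiteInt t.1 t.2.1 t.2.2 ∈ hcpOwn1743Int) := by decide +kernel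

/-- Every own vector is a half-crystal site (with indices in the box). -/
theorem hcpOwn1743Int_subset_halfCrystal :
    ∀ v ∈ hcpOwn1743Int, 0 ≤ prismSide v ∧ ∃ t ∈ prismBox, hcpSiteInt t.1 t.2.1 t.2.2 = v := by decide +kernel

/-- **Integer separation**: every half-crystal site other than `y` with indices in the box is at scaled squared distance
`≥ 1353970890 > N = 1348362450` from each of the four twisted balls (scale `8655`). -/
theorem sqNormInt_halfCrystal_sub_twisted :
    ∀ t ∈ prismBox, 0 ≤ prismSide (hcpSiteInt t.1 t.2.1 t.2.2) → hcpSiteInt t.1 t.2.1 t.2.2 ≠ 0 →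
      ∀ f ∈ twistedInt, ((1353970890 : ℕ) : ℤ) ≤ sqNormInt ((8655 : ℤ) • hcpSiteInt t.1 t.2.1 t.2.2 - f) := by
  decide +kernel

/-! ### Transport to `ℝ³` -/

/-- Site `(k, i, j)` of the hcp crystal through `y = 0` as a point of `ℝ³` (unit nearest-neighbour distance). -/
def hcpSite (k i j : ℤ) : EuclideanSpace ℝ (Fin 3) := (Real.sqrt ((18 : ℕ) : ℝ))⁻¹ • intVec (hcpSiteInt k i j)

/-- `intVec` is additive. -/
private theorem intVec_sub' (v w : Fin 3 → ℤ) : intVec (v - w) = intVec v - intVec w := by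
  ext i; simp [intVec]

/-- `intVec` commutes with integer scaling. -/
private theorem intVec_zsmul' (c : ℤ) (v : Fin 3 → ℤ) : intVec (c • v) = (c : ℝ) • intVec v := by
  ext i; simp [intVec]

/-- The scale of the twisted model: `√1348362450 = 8655·√18`. -/
private theorem sqrt_N_eq : Real.sqrt (1348362450 : ℕ) = 8655 * Real.sqrt ((18 : ℕ) : ℝ) := by
  rw [show ((1348362450 : ℕ) : ℝ) = (8655 : ℝ) ^ 2 * ((18 : ℕ) : ℝ) by norm_num, Real.sqrt_mul (by positivity),
    Real.sqrt_sq (by norm_num)]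

/-- A site in the twisted model's scale: `hcpSite k i j = (√N)⁻¹ • intVec (8655 • hcpSiteInt k i j)`. -/
private theorem hcpSite_eq_scaled (k i j : ℤ) :
    hcpSite k i j = (Real.sqrt (1348362450 : ℕ))⁻¹ • intVec ((8655 : ℤ) • hcpSiteInt k i j) := by
  rw [hcpSite, intVec_zsmul', smul_smul, sqrt_N_eq, mul_inv, Int.cast_ofNat]
  congr 1
  have h18 : Real.sqrt ((18 : ℕ) : ℝ) ≠ 0 := (Real.sqrt_pos.2 (by norm_num)).ne'
  field_simp

/-- Distance of two points of one scaled integer model. -/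
private theorem dist_scaled' (N : ℕ) (a b : Fin 3 → ℤ) :
    dist ((Real.sqrt N)⁻¹ • intVec a) ((Real.sqrt N)⁻¹ • intVec b) = (Real.sqrt N)⁻¹ * Real.sqrt (sqNormInt (a - b) : ℝ) := by
  rw [dist_eq_norm, ← smul_sub, norm_smul, ← intVec_sub', norm_intVec, Real.norm_eq_abs,
    abs_of_nonneg (inv_nonneg.2 (Real.sqrt_nonneg _))]

/-- **Separation (near sites).**  Every half-crystal ball other than `y` with indices in `[−2,2]³` is at distance `> 1` from
each twisted ball: the twisted four touch only `y`. -/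
theorem prismFaceTwisted_separated {k i j : ℤ} (ht : (k, i, j) ∈ prismBox) (hside : 0 ≤ prismSide (hcpSiteInt k i j))
    (hy : hcpSiteInt k i j ≠ 0) {f : EuclideanSpace ℝ (Fin 3)} (hf : f ∈ twistedFour) : 1 < dist (hcpSite k i j) f := by
  obtain ⟨g, hg, rfl⟩ := Finset.mem_image.1 hf
  have hN : (0 : ℝ) < Real.sqrt (1348362450 : ℕ) := Real.sqrt_pos.2 (by norm_num)
  have key := sqNormInt_halfCrystal_sub_twisted (k, i, j) ht hside hy g hg
  rw [hcpSite_eq_scaled, dist_scaled', lt_inv_mul_iff₀ hN, mul_one]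
  refine (Real.sqrt_lt_sqrt (by positivity) ?_)
  have : ((1348362450 : ℕ) : ℝ) < ((1353970890 : ℕ) : ℤ) := by norm_num
  exact this.trans_le (by exact_mod_cast key)

/-- **Separation (far sites).**  Every site at distance `≥ 2` from `y` — on either side, with any indices — is at distance
`≥ 1` from each twisted ball (the twisted balls are unit vectors: triangle inequality). -/
theorem prismFaceTwisted_separated_far {k i j : ℤ} (hfar : 2 ≤ ‖hcpSite k i j‖) {f : EuclideanSpace ℝ (Fin 3)} (hf : f ∈ twistedFour) :
    1 ≤ dist (hcpSite k i j) f := by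
  have hf1 : ‖f‖ = 1 := norm_eq_one_of_mem_twistedDozen (twistedFour_subset_twistedDozen hf)
  have h := norm_sub_norm_le (hcpSite k i j) f
  rw [← dist_eq_norm, hf1] at h
  linarith

/-- The own balls of `O₁₇₄₃` are sites: the real own pattern is `{hcpSite k i j}` over its index triples. -/
theorem hcpOwn1743_mem_halfCrystal {p : EuclideanSpace ℝ (Fin 3)} (hp : p ∈ hcpOwn1743) :
    ∃ k i j : ℤ, (k, i, j) ∈ prismBox ∧ 0 ≤ prismSide (hcpSiteInt k i j) ∧ hcpSite k i j = p := by
  obtain ⟨v, hv, rfl⟩ := Finset.mem_image.1 hp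
  obtain ⟨hside, t, ht, htv⟩ := hcpOwn1743Int_subset_halfCrystal v hv
  refine ⟨t.1, t.2.1, t.2.2, ht, by rw [htv]; exact hside, ?_⟩
  rw [hcpSite, htv]

/-- A half-crystal site touching `y` (distance `1`, indices in the box) is an own ball of `O₁₇₄₃`. -/
theorem mem_hcpOwn1743_of_touching {k i j : ℤ} (ht : (k, i, j) ∈ prismBox) (hside : 0 ≤ prismSide (hcpSiteInt k i j))
    (h1 : dist (hcpSite k i j) 0 = 1) : hcpSite k i j ∈ hcpOwn1743 := by
  have h18 : (0 : ℝ) < Real.sqrt ((18 : ℕ) : ℝ) := Real.sqrt_pos.2 (by norm_num)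
  -- the integer norm is `18`
  have hn : sqNormInt (hcpSiteInt k i j) = 18 := by
    have h := h1
    rw [dist_eq_norm, sub_zero, hcpSite, norm_smul, norm_intVec, Real.norm_eq_abs, abs_of_nonneg (inv_nonneg.2 h18.le),
      inv_mul_eq_one₀ h18.ne',
      Real.sqrt_inj (by norm_num) (by exact_mod_cast (by unfold sqNormInt; positivity : (0 : ℤ) ≤ sqNormInt (hcpSiteInt k i j)))] at h
    have h' : ((18 : ℕ) : ℤ) = sqNormInt (hcpSiteInt k i j) := by exact_mod_cast h
    rw [← h']; rfl
  have hmem : hcpSiteInt k i j ∈ hcpOwn1743Int := (prismFace_dozen_of_y (k, i, j) ht hn).1 hside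
  exact Finset.mem_image.2 ⟨_, hmem, rfl⟩

/-- **`y` is SATURATED and IRREGULAR in «half-crystal ∪ twisted four».**  The twisted dozen `O₁₇₄₃ ∪ F` (i) consists of
the eight own balls, which are half-crystal balls, and the four twisted balls; (ii) is a kissing arrangement of twelve unit
vectors around `y = 0`; (iii) is NOT a linear-isometric image of the FCC or of the HCP kissing pattern; and (iv) no other
half-crystal ball with indices in the box touches `y`.  So the face ball `y` has twelve contacts, none missing, and no frame in
which a walker arriving along the face could continue. -/
theorem prismFaceTwisted_saturated_irregular :
    (∀ p ∈ hcpOwn1743, ∃ k i j : ℤ, (k, i, j) ∈ prismBox ∧ 0 ≤ prismSide (hcpSiteInt k i j) ∧ hcpSite k i j = p) ∧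
    twistedDozen = hcpOwn1743 ∪ twistedFour ∧ twistedDozen.card = 12 ∧ IsKissingArrangement twistedDozen ∧
    (¬ ∃ A : EuclideanSpace ℝ (Fin 3) →ₗᵢ[ℝ] EuclideanSpace ℝ (Fin 3),
      (↑twistedDozen : Set (EuclideanSpace ℝ (Fin 3))) = A '' (↑fccKissingPattern : Set (EuclideanSpace ℝ (Fin 3))) ∨
        (↑twistedDozen : Set (EuclideanSpace ℝ (Fin 3))) = A '' (↑hcpKissingPattern : Set (EuclideanSpace ℝ (Fin 3)))) ∧
    (∀ k i j : ℤ, (k, i, j) ∈ prismBox → 0 ≤ prismSide (hcpSiteInt k i j) → dist (hcpSite k i j) 0 = 1 →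
      hcpSite k i j ∈ twistedDozen) :=
  ⟨fun _ hp => hcpOwn1743_mem_halfCrystal hp, twistedDozen_eq, card_twistedDozen, isKissingArrangement_twistedDozen,
    twistedDozen_not_isometricImage,
    fun _ _ _ ht hside h1 => hcpOwn1743_subset_twistedDozen (mem_hcpOwn1743_of_touching ht hside h1)⟩

end Summit.Ventures.Crystal3D.Theorems

end
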